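import Summits.QuantumAdvantage.AdviceFreeQNC0.BlockFibreLaw37
import Summits.QuantumAdvantage.AdviceFreeQNC0.BlockFlip37
import HarnessLib

/-!
# Cell qa-qnc0 — P-37c (c2)/(c3): the BLOCK-COMB THEOREM and (G₁) for every gate (1/4)

Cell qa-qnc0, crux stmt-QuantumAdvantage-22907.  AUTHORED AND PROVED BY THE PLANNER qa-qnc0-p1 gen 37 (P-37c (c2)+(c3), INBOX P1-37c 14:53Z, evidence #60 on stmt-22907, file `HOME/qa-qnc0-p1/exp37/BlockComb37.lean`, 1082 lines, sha db0f1086629d090a, rc 0 / 0 sorries); landed verbatim by qn-prover-3 g21 as a four-way split: `BlockComb37Fam` (§§0–3: typed targets `gateSum`/`EveryGateHard`/`GatesHardConst`, block algebra, sub-families, averaging identities + quarter lemma) → `BlockComb37Data` (§§4–5: `CombData`, local bit flips, the count on a background with many good blocks) → `BlockComb37` (§§6–8: few backgrounds have few good blocks, ★ `blockComb_le` THE BLOCK-COMB THEOREM, small-block bit calculus) → `BlockCombGate37` (§§9–10: the comb data of one gate, ★ `everyGateHard : EveryGateHard`).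
-/

noncomputable section

open Classical

namespace Summit.QuantumAdvantage.AdviceFreeQNC0

open Finset
open Literature.Computability.MetaComplexity Literature.Computability.MetaComplexity.Smolensky
open F4 AffBells22 Subcube

namespace BlockFibre37

variable {n m : ℕ}

/-! ### 0. The typed targets (verbatim from exp36/BlockFibre37.lean) -/

/-- the value of the gate `Σ_i ℓ_i x_i` (same as `Comb37J.gateSum`). -/
def gateSum (ℓ : Fin (n + 1) → ZMod 3) (u : Fin n → Bool) : ZMod 3 := ∑ i : Fin (n + 1), if xOfU u i = true then ℓ i else 0

/-- **(c3) (G₁) FOR EVERY GATE** (target): no hypothesis on the coefficient word. -/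
def EveryGateHard : Prop :=
  ∃ θ : ℝ, θ < 1 ∧ ∀ C : ℕ, ∃ n₀ : ℕ, ∀ n ≥ n₀, ∀ (ℓ : Fin (n + 1) → ZMod 3) (c : ℕ) (T : Type) (f : ZMod 3 → T)
    (G : T → Fin (n + 1) → (Fin n → Bool) → Bool), (∀ t, WindowLocal ((Nat.log 2 n) ^ C) (G t)) →
    ((univ.filter fun u : Fin n → Bool => ringWinU c (fun g u => G (f (gateSum ℓ u)) g u) u = true).card : ℝ)
      ≤ θ * (2 : ℝ) ^ n

/-- **(c4) (G_k) FOR ANY CONSTANT NUMBER OF GATES** (target): selection by any function of `k` gate values. -/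
def GatesHardConst : Prop :=
  ∃ θ : ℝ, θ < 1 ∧ ∀ k C : ℕ, ∃ n₀ : ℕ, ∀ n ≥ n₀, ∀ (ℓ : Fin k → Fin (n + 1) → ZMod 3) (c : ℕ) (T : Type)
    (f : (Fin k → ZMod 3) → T) (G : T → Fin (n + 1) → (Fin n → Bool) → Bool),
    (∀ t, WindowLocal ((Nat.log 2 n) ^ C) (G t)) →
    ((univ.filter fun u : Fin n → Bool =>
        ringWinU c (fun g u => G (f (fun r => gateSum (ℓ r) u)) g u) u = true).card : ℝ) ≤ θ * (2 : ℝ) ^ n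

/-! ### 1. More block algebra -/

/-- `xorV` is commutative. -/
theorem xorV_comm (w π : Fin m → Bool) : xorV w π = xorV π w := by
  funext j; unfold xorV; cases w j <;> cases π j <;> rfl

/-- `xorV w` is an involution. -/
theorem xorV_self_left (w v : Fin m → Bool) : xorV w (xorV w v) = v := by
  funext j; unfold xorV; cases w j <;> cases v j <;> rfl

/-- Extending by the zero fibre vector does nothing. -/
theorem blockExt_zero (B : BlockFam n m) (u : Fin n → Bool) : blockExt B u (fun _ => false) = u := by
  funext i
  unfold blockExt
  have : ¬ ∃ j : Fin m, InBlock B j i ∧ (fun _ : Fin m => false) j = true := fun ⟨_, _, h⟩ => Bool.false_ne_true h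
  rw [decide_eq_false this]
  cases u i <;> rfl

/-- the fibre map is an involution in the background. -/
theorem blockExt_invol (B : BlockFam n m) (u : Fin n → Bool) (v : Fin m → Bool) :
    blockExt B (blockExt B u v) v = u := by
  rw [blockExt_blockExt]
  have : xorV v v = fun _ => false := by funext j; unfold xorV; cases v j <;> rfl
  rw [this, blockExt_zero]

/-- complement block `k`. -/
def cpl (B : BlockFam n m) (k : Fin m) (u : Fin n → Bool) : Fin n → Bool := blockExt B u (fun j => decide (j = k))

/-- The own-block complement `cpl B k` is an involution. -/
theorem cpl_cpl (B : BlockFam n m) (k : Fin m) (u : Fin n → Bool) : cpl B k (cpl B k u) = u := blockExt_invol B u _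

/-- `cpl B k` negates the bits inside block `k`. -/
theorem cpl_of_inBlock (B : BlockFam n m) {k : Fin m} (u : Fin n → Bool) {i : Fin n} (h : InBlock B k i) :
    cpl B k u i = !u i := by
  unfold cpl; rw [blockExt_of_inBlock B u _ h]; simp

/-- `cpl B k` fixes the bits outside block `k`. -/
theorem cpl_of_not_inBlock (B : BlockFam n m) {k : Fin m} (u : Fin n → Bool) {i : Fin n} (h : ¬ InBlock B k i) :
    cpl B k u i = u i := by
  unfold cpl
  by_cases hex : ∃ j, InBlock B j i
  · obtain ⟨j, hj⟩ := hex
    rw [blockExt_of_inBlock B u _ hj]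
    have hne : j ≠ k := fun e => h (e ▸ hj)
    rw [decide_eq_false hne]; simp
  · push Not at hex
    exact blockExt_of_not_inBlock B u _ hex

/-- the complement of block `k` is the interval complement `[st k, st k + len k)`. -/
theorem cpl_eq_blockCompl (B : BlockFam n m) (k : Fin m) (u : Fin n → Bool) :
    cpl B k u = Comb37.blockCompl u (B.st k) (B.st k + B.len k) := by
  funext i
  unfold Comb37.blockCompl
  by_cases h : InBlock B k i
  · rw [cpl_of_inBlock B u h, if_pos (show B.st k ≤ i.val ∧ i.val < B.st k + B.len k from h)]
  · rw [cpl_of_not_inBlock B u h, if_neg (show ¬ (B.st k ≤ i.val ∧ i.val < B.st k + B.len k) from h)]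

/-- setting one more coordinate of the fibre parameter is one more block complement. -/
theorem blockExt_update (B : BlockFam n m) (u : Fin n → Bool) (v : Fin m → Bool) (k : Fin m) (hk : v k = false) :
    blockExt B u (Function.update v k true) = cpl B k (blockExt B u v) := by
  unfold cpl
  rw [blockExt_blockExt]
  congr 1
  funext j
  unfold xorV
  by_cases hj : j = k
  · subst hj; rw [Function.update_self, hk]; simp
  · rw [Function.update_of_ne hj]; simp [hj]

/-- `bwt` under the complement of its own block. -/
theorem bwt_cpl (B : BlockFam n m) (k : Fin m) (u : Fin n → Bool) : bwt B (cpl B k u) k + bwt B u k = 3 * B.len k :=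
  bwt_blockExt_of_true B u _ (by simp)

/-- `bwt` reads only the block. -/
theorem bwt_congr (B : BlockFam n m) (k : Fin m) {u u' : Fin n → Bool} (h : ∀ i, InBlock B k i → u i = u' i) :
    bwt B u k = bwt B u' k := by
  unfold bwt
  congr 1
  exact congrArg Finset.card (filter_congr fun i _ => by
    constructor
    · rintro ⟨hi, hu⟩; exact ⟨hi, by rw [← h i hi]; exact hu⟩
    · rintro ⟨hi, hu⟩; exact ⟨hi, by rw [h i hi]; exact hu⟩)

/-- composing with the fibre map keeps the `𝔽₂`-degree (every output bit is `u_i`, `u_i ⊕ w_j` or `¬`). -/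
theorem hasDeg_comp_blockExt (B : BlockFam n m) (u : Fin n → Bool) {D : ℕ} {h : (Fin n → Bool) → Bool}
    (hh : HasDeg h D) : HasDeg (fun w => h (blockExt B u w)) D := by
  unfold HasDeg at *
  refine comp_mem_lowDeg_of_coord (F := ZMod 2) (fun w => blockExt B u w) (fun i => ?_) hh
  by_cases hex : ∃ j, InBlock B j i
  · obtain ⟨j, hj⟩ := hex
    have e : (fun w : Fin m → Bool => if blockExt B u w i = true then (1 : ZMod 2) else 0)
        = fun w => if (xor (u i) (w j)) = true then (1 : ZMod 2) else 0 := by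
      funext w; rw [blockExt_of_inBlock B u w hj]
    rw [e]
    cases u i
    · simp only [Bool.false_xor]; exact ind_coord_mem j
    · simp only [Bool.true_xor]; exact ind_not_coord_mem j
  · push Not at hex
    have e : (fun w : Fin m → Bool => if blockExt B u w i = true then (1 : ZMod 2) else 0)
        = fun _ => if u i = true then (1 : ZMod 2) else 0 := by
      funext w; rw [blockExt_of_not_inBlock B u w hex]
    rw [e]
    cases u i
    · have e0 : (fun _ : Fin m → Bool => if false = true then (1 : ZMod 2) else 0) = 0 := by funext w; simp
      rw [e0]; exact Submodule.zero_mem _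
    · have e1 : (fun _ : Fin m → Bool => if true = true then (1 : ZMod 2) else 0) = mono (ZMod 2) ∅ := by
        funext w; rw [mono_empty]; simp
      rw [e1]; exact mono_mem_lowDeg (by simp)

/-! ### 2. Sub-families -/

/-- the sub-family indexed by `S ⊆ Fin m` (in increasing order). -/
def sub (B : BlockFam n m) (S : Finset (Fin m)) : BlockFam n S.card where
  st j := B.st (S.orderEmbOfFin rfl j)
  len j := B.len (S.orderEmbOfFin rfl j)
  len_pos _ := B.len_pos _
  one_le _ := B.one_le _
  le_n _ := B.le_n _
  sep _ _ h := B.sep _ _ ((S.orderEmbOfFin rfl).strictMono h)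

/-- Blocks of the sub-family `sub B S` are the blocks of `B` indexed through `S.orderEmbOfFin`. -/
theorem inBlock_sub (B : BlockFam n m) (S : Finset (Fin m)) (j : Fin S.card) (i : Fin n) :
    InBlock (sub B S) j i ↔ InBlock B (S.orderEmbOfFin rfl j) i := Iff.rfl

/-- Admissibility in the sub-family is admissibility of the corresponding block of `B`. -/
theorem admissible_sub (B : BlockFam n m) (S : Finset (Fin m)) (u : Fin n → Bool) (j : Fin S.card) :
    Admissible (sub B S) u j ↔ Admissible B u (S.orderEmbOfFin rfl j) := Iff.rfl

/-- extension by zero of a sub-family parameter. -/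
def iota (S : Finset (Fin m)) (w : Fin S.card → Bool) : Fin m → Bool :=
  fun k => decide (∃ j : Fin S.card, S.orderEmbOfFin rfl j = k ∧ w j = true)

/-- The re-based fibre vector `iota S w` is supported on `S`. -/
theorem iota_mem {S : Finset (Fin m)} {w : Fin S.card → Bool} {k : Fin m} (h : iota S w k = true) : k ∈ S := by
  unfold iota at h
  obtain ⟨j, hj, _⟩ := of_decide_eq_true h
  rw [← hj]; exact Finset.orderEmbOfFin_mem S rfl j

/-- **re-basing**: the sub-family fibre of `u` is the part of the full fibre of `u` parametrised by `iota`. -/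
theorem blockExt_sub (B : BlockFam n m) (S : Finset (Fin m)) (u : Fin n → Bool) (w : Fin S.card → Bool) :
    blockExt (sub B S) u w = blockExt B u (iota S w) := by
  funext i
  unfold blockExt
  congr 1
  apply Bool.decide_congr
  constructor
  · rintro ⟨j, hj, hw⟩
    refine ⟨S.orderEmbOfFin rfl j, (inBlock_sub B S j i).1 hj, ?_⟩
    unfold iota; exact decide_eq_true ⟨j, rfl, hw⟩
  · rintro ⟨k, hk, hw⟩
    unfold iota at hw
    obtain ⟨j, hj, hwj⟩ := of_decide_eq_true hw
    refine ⟨j, ?_, hwj⟩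
    rw [inBlock_sub, hj]; exact hk

/-- the second averaging family on the parameter cube: xor with `iota S w`. -/
def PhiS (S : Finset (Fin m)) (w : Fin S.card → Bool) (v : Fin m → Bool) : Fin m → Bool := xorV (iota S w) v

/-- `PhiS S w` is an involution. -/
theorem PhiS_invol (S : Finset (Fin m)) (w : Fin S.card → Bool) (v : Fin m → Bool) : PhiS S w (PhiS S w v) = v :=
  xorV_self_left _ _

/-- **(C)** moving along the good coordinates of the parameter = moving along the sub-family fibre of the fibre point. -/
theorem blockExt_PhiS (B : BlockFam n m) (S : Finset (Fin m)) (a : Fin n → Bool) (w : Fin S.card → Bool)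
    (v : Fin m → Bool) : blockExt B a (PhiS S w v) = blockExt (sub B S) (blockExt B a v) w := by
  rw [blockExt_sub, blockExt_blockExt]
  rfl

/-! ### 3. Averaging identities and the quarter lemma -/

/-- **averaging identity**: for a family of involutions `Φ w` indexed by the cube `{0,1}^m`,
`2^m · #{x : P x} = Σ_x #{w : P (Φ w x)}`. -/
theorem avg_identity {X : Type*} [Fintype X] (Φ : (Fin m → Bool) → X → X)
    (hΦ : ∀ w x, Φ w (Φ w x) = x) (P : X → Prop) [DecidablePred P] :
    2 ^ m * (univ.filter fun x => P x).card = ∑ x : X, (univ.filter fun w : Fin m → Bool => P (Φ w x)).card := by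
  have h1 : ∀ w : Fin m → Bool, (univ.filter fun x : X => P (Φ w x)).card = (univ.filter fun x => P x).card := by
    intro w
    refine card_bij (fun x _ => Φ w x) ?_ ?_ ?_
    · intro x hx; rw [mem_filter] at hx ⊢; exact ⟨mem_univ _, hx.2⟩
    · intro x₁ _ x₂ _ h; rw [← hΦ w x₁, h, hΦ]
    · intro y hy
      refine ⟨Φ w y, ?_, hΦ w y⟩
      rw [mem_filter] at hy ⊢
      exact ⟨mem_univ _, by rw [hΦ]; exact hy.2⟩
  calc 2 ^ m * (univ.filter fun x => P x).card
      = ∑ w : Fin m → Bool, (univ.filter fun x : X => P (Φ w x)).card := by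
        rw [sum_congr rfl fun w _ => h1 w, sum_const, smul_eq_mul, card_univ, Fintype.card_fun, Fintype.card_bool,
          Fintype.card_fin]
    _ = ∑ w : Fin m → Bool, ∑ x : X, (if P (Φ w x) then 1 else 0) := by
        refine sum_congr rfl fun w _ => ?_; rw [card_filter]
    _ = ∑ x : X, ∑ w : Fin m → Bool, (if P (Φ w x) then 1 else 0) := sum_comm
    _ = ∑ x : X, (univ.filter fun w : Fin m → Bool => P (Φ w x)).card := by
        refine sum_congr rfl fun x _ => ?_; rw [card_filter]

/-- **the quarter lemma**: if two commuting involutions act on `E` and every orbit meets `good`, then at most `3/4`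
of `E` is bad. -/
theorem quarter {X : Type*} [DecidableEq X] (E : Finset X) (good : X → Prop) [DecidablePred good]
    (φ : Bool → Bool → X → X) (hφE : ∀ s t x, x ∈ E → φ s t x ∈ E) (hφφ : ∀ s t x, φ s t (φ s t x) = x)
    (hex : ∀ x, ∃ s t, good (φ s t x)) :
    ((E.filter fun x => ¬ good x).card : ℝ) ≤ 3 / 4 * (E.card : ℝ) := by
  set g := (E.filter fun x => good x).card with hg
  have h1 : ∀ s t, (E.filter fun x => good (φ s t x)).card = g := by
    intro s t
    refine card_bij (fun x _ => φ s t x) ?_ ?_ ?_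
    · intro x hx; rw [mem_filter] at hx ⊢; exact ⟨hφE s t x hx.1, hx.2⟩
    · intro x₁ _ x₂ _ h; rw [← hφφ s t x₁, h, hφφ]
    · intro y hy
      rw [mem_filter] at hy
      refine ⟨φ s t y, ?_, hφφ s t y⟩
      rw [mem_filter]
      exact ⟨hφE s t y hy.1, by rw [hφφ]; exact hy.2⟩
  have hcover : E ⊆ (univ : Finset (Bool × Bool)).biUnion (fun st => E.filter fun x => good (φ st.1 st.2 x)) := by
    intro x hx
    rw [mem_biUnion]
    obtain ⟨s, t, hst⟩ := hex x
    exact ⟨(s, t), mem_univ _, mem_filter.2 ⟨hx, hst⟩⟩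
  have h2 : E.card ≤ 4 * g := by
    calc E.card ≤ ((univ : Finset (Bool × Bool)).biUnion (fun st => E.filter fun x => good (φ st.1 st.2 x))).card :=
          card_le_card hcover
      _ ≤ ∑ st : Bool × Bool, (E.filter fun x => good (φ st.1 st.2 x)).card := card_biUnion_le
      _ = ∑ st : Bool × Bool, g := sum_congr rfl fun st _ => h1 st.1 st.2
      _ = 4 * g := by rw [sum_const, smul_eq_mul, card_univ, Fintype.card_prod, Fintype.card_bool]
  have h3 := Finset.card_filter_add_card_filter_not (s := E) (fun x => good x)
  have h2R : (E.card : ℝ) ≤ 4 * (g : ℝ) := by exact_mod_cast h2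
  have h3R : (g : ℝ) + ((E.filter fun x => ¬ good x).card : ℝ) = E.card := by rw [hg]; exact_mod_cast h3
  linarith

end BlockFibre37

end Summit.QuantumAdvantage.AdviceFreeQNC0
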